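import Literature.MathematicalPhysics.QuantumFieldTheory.Balaban1983to89.B1Eq324BenfattoKernelSect5ClassLowerStepFrame
import Literature.MathematicalPhysics.QuantumFieldTheory.Balaban1983to89.B1Eq324BenfattoKernelSect5CollectErrors
import HarnessLib

/-!
# `Balaban1983to89.B1Eq324BenfattoKernelSect5LowerAssembly` — [BenfattoEtAl1978] Basic Lemma (4.7) p. 152, §5 p. 159 «Collecting all the errors made in
# this process (4.7) is proven», FOR THE GAUSSIAN FIELD OF A CLASS KERNEL: the KNIT — seat n08-d's class lower chain down to the class Appendix A,
# fed at every step by the class lower step (per-box bounds AND identification from the class rows), telescoped by the class collection of errors;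
# outcome: (4.7) for `𝒩(0, K_Λ)`, ONE CHOICE OF EVERYTHING, every error CLOSED and displayed in a single real ledger inequality

statement-level skeleton of published theorems with citation tags; proofs where landed; nothing here is a claim about the
Yang–Mills mass gap

WHY THIS MODULE (cell `pub-ymgap`, seat `dag-n08-c` gen 31; node N08 [Balaban1985UV3]; the [BenfattoEtAl1978] source chain behind the (α)-row `h324`;
the last piece of my CLAIM-8 assembly layer `…KernelSect5Identification → …IdErrBounds → …StepBound → …CollectErrors → …LowerAssembly` over the class
chain — structural S8 of `N08-PORT-MAP-STRUCTURAL-SIDE.md`).  The class twin of my concrete `…Sect5LowerAssembly.ineq47_of_ledger` (p582893), with one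
difference of presentation: the concrete file bounds every surviving cardinality by `|I|` inside and states the ledger in `|I|·errTerm` currency; here the
ledger inequality is displayed with the chain's own cardinalities (`|J_n|`, `|B_n|`, `|Γ̄₁(B_n)|`, `|□′∪Γ₂|`) and the class price `2P_n` in n08-d's letters —
the currency conversion (`≤ |I|·errTerm`, seat n08-b's `…KernelSect5LedgerPrice` / `…Sect5LedgerDischarge*`) is a separate, measure-free module.

THE KNIT.  (1) n08-d `…KernelSect5PavementChain.lowerPavementChain_appendixA` (p617701): `d + 1` displaced class pavement steps in drifting frames down to
the class Appendix A, per-box LOWER bounds `ℓ_n(□)` displayed per step; (2) my `…KernelSect5ClassLowerStepFrame.exists_lower_step_of_classRows_frame` at every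
step `n < d + 1` (frame `σ_{n+1}`, displacement `τ_n`, datum `(J_n, I_n, A_n, b_n)`): THERE IS `ℓ_n` with exactly that `hbox` AND the identification
`cS_{G_{n+1}}(H^{A_n(·−τ_n)}_{J_n+τ_n}) − cS_{G_{n+1}}(H^{A_n(·−τ_n)}_{Γ̄₁(B_n)}) − idErr_n ≤ Σ_□ℓ_n(□)`, `idErr_n` CLOSED — chosen by `Classical.choice` over
`n`; (3) my `…KernelSect5CollectErrors.exp_cumulantSum_sub_le_integral_of_chain`: the drifting-frame telescope + `J_{d+1} = ∅`
(`…Sect5PavementChain.chain_eq_empty_of_sep`) turn (1)+(2)+ledger into (4.7).  `B_n := (J_n + τ_n).image boxIndex` (the tesserae meeting the translated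
support) is SUBSTITUTED for n08-d's free `Bs` (their `hB` is `subset_rfl`).

WHAT IS PROVED (theorems only; no definition, no named fact, no `sorry`; axioms standard).
* ★★★ `exp_cumulantSum_sub_le_integral_of_ledger` — (4.7) FOR `𝒩(0, K_Λ)`, ONE CHOICE OF EVERYTHING: for a class member `(Λ, A, K)` (`Λ ≠ ∅`) with its
  class rows and guard, chain data `(J_n ⊆ I_n, A_n, b_n, τ_n, σ_n)` obeying the recursions (hypotheses discharged by `rfl` for recursively defined
  sequences), pavements inside the frames, definitional part kernels, the per-step constant ties, separated displacements, `I_0 ≠ ∅`, the terminal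
  cut-off `b_{d+1}² ≥ 4/γ_A`, and ONE displayed real inequality `Σ_{n≤d}(c_n + idErr_n) + |I_0|·4·8^d·e^{−γ_A b_{d+1}²/2} ≤ E_tot` (all terms CLOSED):
  `exp(cumulantSum μ_K H^{A_0}_{J_0} t − E_tot) ≤ ∫Π_Δχ̂^{I_0}_{b_0} e^{H^{A_0}_{J_0}} dμ_K`.

HONEST SCOPE / NOT HERE.  The currency conversion of the ledger to `|I|·errTerm(α, ε₀, C)` and the choice of the printed parameters (`L ≈ b²`,
`w = 2v ≈ 2Mb^{3/2}`, `γ`) are measure-free sequels; the class, its rows and the two smallness conditions are OURS ([Balaban1985BackgroundPropagators]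
Sect. E at temperature zero), not print's `P̂₀`; one self-located piece of an UNCOMMISSIONED port (plan g81 (II), START-LIST v11 §n08) — nothing chained
into any node count; NO generalised Basic Lemma is asserted beyond this displayed-ledger form; nothing of [Balaban1985UV3] is asserted; count-neutral for
N08; nothing about d = 4, the continuum, OS axioms, a mass gap or the Clay problem.
-/

noncomputable section

open MeasureTheory ProbabilityTheory Finset Matrix
open scoped BigOperators Nat NNReal

namespace Literature.MathematicalPhysics.QuantumFieldTheory.Balaban1983to89.B1Eq324BenfattoKernelSect5LowerAssembly

open _root_.MeasureTheory _root_.ProbabilityTheory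
open Literature.Probability.LatticeModels (setPartitions)
open Literature.MathematicalPhysics.QuantumFieldTheory
open Literature.MathematicalPhysics.QuantumFieldTheory.Balaban1983to89.B1Eq324BenfattoLemma
open Literature.MathematicalPhysics.QuantumFieldTheory.Balaban1983to89.B1Eq324BenfattoSect5Boxes
open Literature.MathematicalPhysics.QuantumFieldTheory.Balaban1983to89.B1Eq324BenfattoSect5Eq511
open Literature.MathematicalPhysics.QuantumFieldTheory.Balaban1983to89.B1Eq324BenfattoSect5Eq524
open Literature.MathematicalPhysics.QuantumFieldTheory.Balaban1983to89.B1Eq324BenfattoSect5Eq534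
open Literature.MathematicalPhysics.QuantumFieldTheory.Balaban1983to89.B1Eq324BenfattoSect5Eq515
open Literature.MathematicalPhysics.QuantumFieldTheory.Balaban1983to89.B1Eq324BenfattoSect5Iteration (restrictCoef shiftCoef)
open Literature.MathematicalPhysics.QuantumFieldTheory.Balaban1983to89.B1Eq324BenfattoKernelOfPrecision (isPosSemidefKernel_kernel)
open Literature.MathematicalPhysics.QuantumFieldTheory.Balaban1983to89.B1Eq324BenfattoClassAppendixC (posDef_of_coercive)
open Literature.MathematicalPhysics.QuantumFieldTheory.Balaban1983to89.B1Eq324BenfattoKernelSect5Iteration (mem_image_sub_iff)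
open Literature.MathematicalPhysics.QuantumFieldTheory.Balaban1983to89.B1Eq324BenfattoKernelSect5PavementChain (lowerPavementChain_appendixA)
open Literature.MathematicalPhysics.QuantumFieldTheory.Balaban1983to89.B1Eq324BenfattoKernelSect5ClassLowerStepFrame (exists_lower_step_of_classRows_frame)
open Literature.MathematicalPhysics.QuantumFieldTheory.Balaban1983to89.B1Eq324BenfattoKernelSect5CollectErrors (exp_cumulantSum_sub_le_integral_of_chain)
open Literature.MathematicalPhysics.QuantumFieldTheory.Balaban1983to89.B1Eq324BenfattoSect5PavementChain (chain_invariants chain_eq_empty_of_sep)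
open Literature.MathematicalPhysics.QuantumFieldTheory.Balaban1983to89.B1Eq324GaussianMomentLeaf (momentConst)

variable {d : ℕ}

section Assembly

variable {Λ : Finset (B1Eq324BenfattoLemma.Site d)} {A : Matrix Λ Λ ℝ}
  {K : B1Eq324BenfattoLemma.Site d → B1Eq324BenfattoLemma.Site d → ℝ}
  (hK : ∀ x y, K x y = if h : x ∈ Λ ∧ y ∈ Λ then (A⁻¹ : Matrix Λ Λ ℝ) ⟨x, h.1⟩ ⟨y, h.2⟩ else 0)
  {s D : ℕ} {κ : ℝ} {L w v : ℕ} {γ Ac : ℝ}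

include hK

/-- ★★★ **(4.7) FOR THE GAUSSIAN FIELD OF A CLASS KERNEL, ONE CHOICE OF EVERYTHING — «Collecting all the errors made in this process (4.7) is proven».**
For a class member `(Λ, A, K)` (`Λ ≠ ∅`; `A` symmetric `γ_A`-coercive; Euclidean Combes–Thomas row `J_c < γ_A` at rate `θ > 0`; growth rows `V`, `M`;
half-rate rows `V₂`, `M₂`; quarter-rate growth row `V₄`; guard `J_c/(cosh θw − 1) < γ_A`), print's pavement parameters (`2(2w+v) < L`, `0 < w`, `v ≤ w`),
contraction `0 ≤ γ ≤ 1`, chain data `J_n ⊆ I_n`, `A_n`, `b_n ≥ 1`, displacements `τ_n`, kernel offsets `σ_0 = 0`, `σ_{n+1} = σ_n − τ_n` obeying the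
recursions `J_{n+1} = (J_n + τ_n) ∩ Γ̄₁(B_n)`, `I_{n+1} = I_n + τ_n`, `A_{n+1} = (A_n(·−τ_n))|_{Γ̄₁(B_n)}`, `b_{n+1} = γb_n` with
`B_n = (J_n + τ_n).image boxIndex`, `A_0` supported in `J_0` and bounded by `A_c`, (5.19)'s `L^d e^{−b_n²/4} ≤ 1/6` at every step, the step-`n` pavement
inside the frame `Λ − σ_{n+1}`, the definitional part kernels, letters `Kᵤ_n ≤ K₀_n`, `ε₃₁_n`, `δ` tied to the class constants per step, separated cumulative
displacements, `I_0 ≠ ∅`, the terminal cut-off `b_{d+1}² ≥ 4/γ_A`, and the LEDGER `Σ_{n<d+1}(c_n + idErr_n) + |I_0|·4·8^d·e^{−b_{d+1}²/(2/γ_A)} ≤ E_tot`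
— `c_n = err₅₁₁(n) + err₅₃₄(n) + 2P_n` the class chain's structural cost and `idErr_n = Σ_{□∈B_n}Err_n(□) + CUMB_n` the closed identification error, both
DISPLAYED —:  `exp(cumulantSum μ_K H^{A_0}_{J_0} t − E_tot) ≤ ∫Π_Δχ̂^{I_0}_{b_0} e^{H^{A_0}_{J_0}} dμ_K`.  Proof: `lowerPavementChain_appendixA` with
`ℓ_n` chosen from `exists_lower_step_of_classRows_frame`, then `exp_cumulantSum_sub_le_integral_of_chain` (`J_{d+1} = ∅` by `chain_eq_empty_of_sep`).
[cite: BenfattoEtAl1978, Basic Lemma (4.7) p.152; §5 pp.154–159 «Collecting all the errors»; Appendix A pp.160–161; Balaban1985BackgroundPropagators, (1.16)–(1.18) p.180, Sect. E p.428 (class form; ours)] -/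
theorem exp_cumulantSum_sub_le_integral_of_ledger (hΛ : Λ.Nonempty)
    (hAs : ∀ e e', A e e' = A e' e) {γA : ℝ} (hγA0 : 0 < γA)
    (hγA : ∀ x : Λ → ℝ, γA * ∑ e, x e ^ 2 ≤ ∑ e, ∑ e', A e e' * x e * x e')
    {θ Jc V M V₂ M₂ V₄ : ℝ} (hθ : 0 < θ)
    (hJc : ∀ e : Λ, ∑ e' : Λ, |A e e'| * (Real.cosh (θ * Real.sqrt (∑ j, ((((e : B1Eq324BenfattoLemma.Site d) j : ℝ) - ((e' : B1Eq324BenfattoLemma.Site d) j : ℝ))) ^ 2)) - 1) ≤ Jc)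
    (hJcγ : Jc < γA)
    (hV : ∀ e : Λ, ∑ e' : Λ, Real.exp (-(θ * Real.sqrt (∑ j, ((((e : B1Eq324BenfattoLemma.Site d) j : ℝ) - ((e' : B1Eq324BenfattoLemma.Site d) j : ℝ))) ^ 2))) *
      (1 + Real.sqrt (∑ j, ((((e : B1Eq324BenfattoLemma.Site d) j : ℝ) - ((e' : B1Eq324BenfattoLemma.Site d) j : ℝ))) ^ 2)) ≤ V)
    (hM : ∀ e : Λ, ∑ e' : Λ, |A e e'| * (1 + Real.sqrt (∑ j, ((((e : B1Eq324BenfattoLemma.Site d) j : ℝ) - ((e' : B1Eq324BenfattoLemma.Site d) j : ℝ))) ^ 2)) ≤ M)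
    (hV₂ : ∀ e : Λ, ∑ e' : Λ, Real.exp (-(θ / 2 * Real.sqrt (∑ j, ((((e : B1Eq324BenfattoLemma.Site d) j : ℝ) - ((e' : B1Eq324BenfattoLemma.Site d) j : ℝ))) ^ 2))) ≤ V₂)
    (hM₂ : ∀ e : Λ, ∑ e' : Λ, |A e e'| * Real.exp (θ / 2 * Real.sqrt (∑ j, ((((e : B1Eq324BenfattoLemma.Site d) j : ℝ) - ((e' : B1Eq324BenfattoLemma.Site d) j : ℝ))) ^ 2)) ≤ M₂)
    (hV₄ : ∀ e : Λ, ∑ e' : Λ, Real.exp (-(θ / 4 * Real.sqrt (∑ j, ((((e : B1Eq324BenfattoLemma.Site d) j : ℝ) - ((e' : B1Eq324BenfattoLemma.Site d) j : ℝ))) ^ 2))) *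
      (1 + Real.sqrt (∑ j, ((((e : B1Eq324BenfattoLemma.Site d) j : ℝ) - ((e' : B1Eq324BenfattoLemma.Site d) j : ℝ))) ^ 2)) ≤ V₄)
    (hguard : Jc / (Real.cosh (θ * w) - 1) < γA)
    (hκ : 0 < κ) (hL2 : 2 * (2 * w + v) < L) (hw : 0 < w) (hv : v ≤ w) (hγ0 : 0 ≤ γ) (hγ1 : γ ≤ 1) (hAc0 : 0 ≤ Ac)
    {Js Is : ℕ → Finset (B1Eq324BenfattoLemma.Site d)} {as : ℕ → Coef d} {bs : ℕ → ℝ} {τ σ : ℕ → B1Eq324BenfattoLemma.Site d}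
    (hsupp : CoefSupportedIn (as 0) (Js 0))
    (hA : ∀ (p : ℕ) (Δ : Fin p → B1Eq324BenfattoLemma.Site d) (nn : Fin p → ℕ), |as 0 p Δ nn| ≤ Ac) (hJI : Js 0 ⊆ Is 0)
    (hrecJ : ∀ k < d + 1, Js (k + 1) = (Js k).image (fun x => x + τ k) ∩ corridorsBar L w v (((Js k).image fun x => x + τ k).image (boxIndex L)))
    (hrecI : ∀ k < d + 1, Is (k + 1) = (Is k).image fun x => x + τ k)
    (hreca : ∀ k < d + 1, as (k + 1) = restrictCoef (shiftCoef (as k) (-τ k)) (corridorsBar L w v (((Js k).image fun x => x + τ k).image (boxIndex L))))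
    (hrecb : ∀ k < d + 1, bs (k + 1) = γ * bs k) (hb : ∀ k < d + 1, 1 ≤ bs k)
    (hsmall : ∀ k < d + 1, ((L : ℝ) ^ d) * Real.exp (-(bs k ^ 2 / 4)) ≤ 1 / 6)
    (hσ0 : σ 0 = 0) (hrecσ : ∀ k < d + 1, σ (k + 1) = σ k - τ k)
    (hΓΛ : ∀ k < d + 1, corridors L w (((Js k).image fun x => x + τ k).image (boxIndex L)) ⊆ Λ.image fun y => y - σ (k + 1))
    (hBΛ : ∀ k, k < d + 1 → ∀ m ∈ (((Js k).image fun x => x + τ k).image (boxIndex L)), box L m ⊆ Λ.image fun y => y - σ (k + 1))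
    {Kbs : ℕ → B1Eq324BenfattoLemma.Site d → B1Eq324BenfattoLemma.Site d → B1Eq324BenfattoLemma.Site d → ℝ}
    (hKbs : ∀ k (hk : k < d + 1) m (hm : m ∈ (((Js k).image fun x => x + τ k).image (boxIndex L))) x y, Kbs k m x y = if h : x ∈ shrink L m w ∧ y ∈ shrink L m w then
      (((A.submatrix (fun j : ↥(Λ.image fun y => y - σ (k + 1)) => (⟨(j : B1Eq324BenfattoLemma.Site d) + σ (k + 1), (mem_image_sub_iff (σ (k + 1))).mp j.2⟩ : Λ))
          (fun j : ↥(Λ.image fun y => y - σ (k + 1)) => (⟨(j : B1Eq324BenfattoLemma.Site d) + σ (k + 1), (mem_image_sub_iff (σ (k + 1))).mp j.2⟩ : Λ))).submatrix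
          (fun j : ↥(shrink L m w) => (⟨j, hBΛ k hk m hm (shrink_subset_box L m w j.2)⟩ : ↥(Λ.image fun y => y - σ (k + 1))))
          (fun j : ↥(shrink L m w) => (⟨j, hBΛ k hk m hm (shrink_subset_box L m w j.2)⟩ : ↥(Λ.image fun y => y - σ (k + 1)))))⁻¹ :
          Matrix ↥(shrink L m w) ↥(shrink L m w) ℝ) ⟨x, h.1⟩ ⟨y, h.2⟩ else 0)
    {Ku K₀ ε₃₁ : ℕ → ℝ} (hKuI : ∀ k < d + 1, (1 + V * M / (γA - Jc)) * (γ * bs k) ≤ Ku k) (hKuK : ∀ k < d + 1, Ku k ≤ K₀ k)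
    (hK₀ : ∀ k < d + 1, 1 / (γA - Jc) ≤ K₀ k) (hK₀1 : ∀ k < d + 1, 1 ≤ K₀ k)
    (hε₁ : ∀ k < d + 1, V₂ * M₂ / (γA - Jc) ^ 2 * Real.exp (-(θ / 2 * ((w - v : ℕ) : ℝ))) + Real.exp (-(θ * ((w - v : ℕ) : ℝ))) / (γA - Jc) ≤ ε₃₁ k)
    (hε₂ : ∀ k < d + 1, M₂ / (γA - Jc) * (γ * bs k) * (1 + Real.sqrt d * ((L : ℝ) - 1)) * V₄ * Real.exp (-(θ / 4 * ((w - v : ℕ) : ℝ))) ≤ ε₃₁ k)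
    (hhalf : 1 / γA ≤ 1 / 2) (hsmallγ : V * M / (γA - Jc) * γ ≤ 1 / 2)
    {δ : ℝ} (hδ : 0 < δ) (hδle : δ ≤ θ / Real.sqrt d) (hres : 0 < κ / 2 - δ / 2 * ((D : ℝ) ^ 2 * Real.sqrt d)) (t : ℕ)
    (hsep : ∀ j j' : Fin (d + 1), j ≠ j' → ∀ (i : Fin d) (q : ℤ),
      (2 * (2 * w + v : ℕ) : ℤ) ≤ |(-(∑ i' ∈ Finset.range ((j : ℕ) + 1), τ i')) i - (-(∑ i' ∈ Finset.range ((j' : ℕ) + 1), τ i')) i - q * L|)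
    (hI0 : (Is 0).Nonempty) (hbterm : 4 * (1 / γA) ≤ bs (d + 1) ^ 2) {Etot : ℝ}
    (hledger : ∑ n ∈ Finset.range (d + 1),
        ((s1Const s D d κ * Ac * bs n ^ D * Real.exp (-(κ / 4 * w)) * (Js n).card
          + s1Const s D d κ * Ac * bs n ^ D *
            (Real.exp (-(κ / 4 * w)) * (corridorsBar L w v (((Js n).image fun x => x + τ n).image (boxIndex L))).card +
              Real.exp (-(κ / 4 * v)) * ((((Js n).image fun x => x + τ n).image (boxIndex L)).card * (L : ℝ) ^ d))
          + 2 * ((∑ y : ↥((Λ.image fun y => y - σ (n + 1)) \ corridors L w (((Js n).image fun x => x + τ n).image (boxIndex L))),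
              Jc / (Real.cosh (θ * max (w : ℝ) (distToRegion ((((Js n).image fun x => x + τ n).image (boxIndex L)).biUnion (box L)) y)) - 1)) / (γA - Jc / (Real.cosh (θ * w) - 1)) +
            ((1 + V * M / (γA - Jc) * γ) ^ 2 * bs n ^ 2 *
            ∑ y : ↥((Λ.image fun y => y - σ (n + 1)) \ corridors L w (((Js n).image fun x => x + τ n).image (boxIndex L))),
              Jc / (Real.cosh (θ * max (w : ℝ) (distToRegion ((((Js n).image fun x => x + τ n).image (boxIndex L)).biUnion (box L)) y)) - 1) *
                (1 + distToRegion ((Is n).image fun x => x + τ n) y) ^ 2) / 2))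
          + (∑ m ∈ (((Js n).image fun x => x + τ n).image (boxIndex L)),
              (2 * (2 ^ ((t + 1).choose 2) * (4 * (s1Const s D d κ * Ac * bs n ^ D * (L : ℝ) ^ d)) ^ (t + 1) / (t + 1)!) +
                    Real.exp (2 * (4 * (s1Const s D d κ * Ac * bs n ^ D * (L : ℝ) ^ d))) *
                      (3 * (((shrink L m w).card : ℝ) * Real.exp (-(bs n ^ 2 / 4)))) +
                    ∑ k ∈ Finset.range t,
                      (3 ^ (k + 1) * ((∑ π ∈ setPartitions (univ : Finset (Fin (k + 1))), ((π.card - 1)! : ℝ)) *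
                          (s1Const s D d κ * Ac * bs n ^ D * Real.exp (-(κ / 4 * v)) * (L : ℝ) ^ d *
                            (4 * (s1Const s D d κ * Ac * bs n ^ D * (L : ℝ) ^ d)) ^ k)) +
                        3 ^ (k + 1) * (2 ^ (k + 1) * ((∑ π ∈ setPartitions (univ : Finset (Fin (k + 1))), ((π.card - 1)! : ℝ)) *
                            ((min 1 (2 * ((shrink L m w).card : ℝ) * Real.exp (-(bs n ^ 2 / 4)))) ^ ((2 * (k + 1) : ℕ) : ℝ)⁻¹ *
                              ((1 + Ku n) ^ D * (Ac * (L : ℝ) ^ d * ∑ p ∈ Finset.Icc 1 s, ((admissible p D).card : ℝ) *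
              ((2 / (1 - Real.exp (-(κ / 2 / (p : ℕ) / Real.sqrt d))) * Real.exp (κ / 2 / (p : ℕ) / Real.sqrt d)) ^ d) ^ (p - 1)) * momentConst D (2 * (k + 1)) (K₀ n).toNNReal) ^ (k + 1))) +
                          2 ^ ((k + 1) * D) * 2 ^ 2 ^ ((k + 1) * D) * K₀ n ^ ((k + 1) * D) * Real.exp (-(δ / 2 * ((v : ℝ) + 1))) *
                            (Ac * Real.exp (δ / 2 * ((D : ℝ) ^ 2 * d)) * (L : ℝ) ^ d * ∑ p ∈ Finset.Icc 1 s, ((admissible p D).card : ℝ) *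
              ((2 / (1 - Real.exp (-((κ / 2 - δ / 2 * ((D : ℝ) ^ 2 * Real.sqrt d)) / (p : ℕ) / Real.sqrt d))) *
                Real.exp ((κ / 2 - δ / 2 * ((D : ℝ) ^ 2 * Real.sqrt d)) / (p : ℕ) / Real.sqrt d)) ^ d) ^ (p - 1)) ^ (k + 1)) +
                        3 ^ (k + 1) * (2 ^ (k + 1) * ((∑ π ∈ setPartitions (univ : Finset (Fin (k + 1))), ((π.card - 1)! : ℝ)) *
                            ((min 1 (2 * ((shrink L m w).card : ℝ) * Real.exp (-(bs n ^ 2 / 4)))) ^ ((2 * (k + 1) : ℕ) : ℝ)⁻¹ *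
                              ((1 + Ku n) ^ D * (Ac * (L : ℝ) ^ d * ∑ p ∈ Finset.Icc 1 s, ((admissible p D).card : ℝ) *
              ((2 / (1 - Real.exp (-(κ / 2 / (p : ℕ) / Real.sqrt d))) * Real.exp (κ / 2 / (p : ℕ) / Real.sqrt d)) ^ d) ^ (p - 1)) * momentConst D (2 * (k + 1)) (K₀ n).toNNReal) ^ (k + 1))) +
                          (Ac * (L : ℝ) ^ d * ∑ p ∈ Finset.Icc 1 s, ((admissible p D).card : ℝ) *
              ((2 / (1 - Real.exp (-(κ / 2 / (p : ℕ) / Real.sqrt d))) * Real.exp (κ / 2 / (p : ℕ) / Real.sqrt d)) ^ d) ^ (p - 1)) ^ (k + 1) * (2 ^ ((k + 1) * D) * 2 ^ 2 ^ ((k + 1) * D) *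
                            ((((k + 1) * D : ℕ) : ℝ) * K₀ n ^ ((k + 1) * D) * ε₃₁ n)))) / (k + 1)!) +
            ∑ k ∈ Finset.range t,
          ((2 ^ (k + 1) * (2 ^ ((k + 1) * D) * 2 ^ 2 ^ ((k + 1) * D) * K₀ n ^ ((k + 1) * D)) *
          ((Ac * Real.exp (δ / 2 * ((D : ℝ) ^ 2 * d)) *
              Real.exp (-((κ / 2 - δ / 2 * ((D : ℝ) ^ 2 * Real.sqrt d)) / 2 * w))) * ((Js n).image fun x => x + τ n).card *
            ∑ p ∈ Finset.Icc 1 s, ((admissible p D).card : ℝ) *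
              ((2 / (1 - Real.exp (-((κ / 2 - δ / 2 * ((D : ℝ) ^ 2 * Real.sqrt d)) / 2 / (p : ℕ) / Real.sqrt d))) *
                Real.exp ((κ / 2 - δ / 2 * ((D : ℝ) ^ 2 * Real.sqrt d)) / 2 / (p : ℕ) / Real.sqrt d)) ^ d) ^ (p - 1)) *
          (Ac * Real.exp (δ / 2 * ((D : ℝ) ^ 2 * d)) *
            ((1 : ℝ) * (2 / (1 - Real.exp (-(δ / (2 * ((k + 1 : ℕ) : ℝ)) / Real.sqrt d))) * Real.exp (δ / (2 * ((k + 1 : ℕ) : ℝ)) / Real.sqrt d)) ^ d) *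
            ∑ p ∈ Finset.Icc 1 s, ((admissible p D).card : ℝ) *
              ((2 / (1 - Real.exp (-((κ / 2 - δ / 2 * ((D : ℝ) ^ 2 * Real.sqrt d)) / (p : ℕ) / Real.sqrt d))) *
                Real.exp ((κ / 2 - δ / 2 * ((D : ℝ) ^ 2 * Real.sqrt d)) / (p : ℕ) / Real.sqrt d)) ^ d) ^ (p - 1)) ^ k
          + 2 ^ (k + 1) * (2 ^ ((k + 1) * D) * 2 ^ 2 ^ ((k + 1) * D) * K₀ n ^ ((k + 1) * D)) *
        ((((Js n).image fun x => x + τ n).image (boxIndex L)).card * (Ac * Real.exp (δ / 2 * ((D : ℝ) ^ 2 * d)) * Real.exp (-((κ / 2 - δ / 2 * ((D : ℝ) ^ 2 * Real.sqrt d)) / 2 * v)) *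
          (L : ℝ) ^ d * ∑ p ∈ Finset.Icc 1 s, ((admissible p D).card : ℝ) *
              ((2 / (1 - Real.exp (-((κ / 2 - δ / 2 * ((D : ℝ) ^ 2 * Real.sqrt d)) / 2 / (p : ℕ) / Real.sqrt d))) *
                Real.exp ((κ / 2 - δ / 2 * ((D : ℝ) ^ 2 * Real.sqrt d)) / 2 / (p : ℕ) / Real.sqrt d)) ^ d) ^ (p - 1))) *
        (Ac * Real.exp (δ / 2 * ((D : ℝ) ^ 2 * d)) *
          (2 / (1 - Real.exp (-(δ / (2 * ((k + 1 : ℕ) : ℝ)) / Real.sqrt d))) * Real.exp (δ / (2 * ((k + 1 : ℕ) : ℝ)) / Real.sqrt d)) ^ d *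
          ∑ p ∈ Finset.Icc 1 s, ((admissible p D).card : ℝ) *
              ((2 / (1 - Real.exp (-((κ / 2 - δ / 2 * ((D : ℝ) ^ 2 * Real.sqrt d)) / (p : ℕ) / Real.sqrt d))) *
                Real.exp ((κ / 2 - δ / 2 * ((D : ℝ) ^ 2 * Real.sqrt d)) / (p : ℕ) / Real.sqrt d)) ^ d) ^ (p - 1)) ^ k)
          + (2 ^ (k + 1) * (2 ^ ((k + 1) * D) * 2 ^ 2 ^ ((k + 1) * D) * K₀ n ^ ((k + 1) * D)) *
          (Ac * Real.exp (δ / 2 * ((D : ℝ) ^ 2 * d)) * Real.exp (-((κ / 2 - δ / 2 * ((D : ℝ) ^ 2 * Real.sqrt d)) / 2 * w)) *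
            (corridorsBar L w v (((Js n).image fun x => x + τ n).image (boxIndex L))).card * ∑ p ∈ Finset.Icc 1 s, ((admissible p D).card : ℝ) *
              ((2 / (1 - Real.exp (-((κ / 2 - δ / 2 * ((D : ℝ) ^ 2 * Real.sqrt d)) / 2 / (p : ℕ) / Real.sqrt d))) *
                Real.exp ((κ / 2 - δ / 2 * ((D : ℝ) ^ 2 * Real.sqrt d)) / 2 / (p : ℕ) / Real.sqrt d)) ^ d) ^ (p - 1)) *
          (Ac * Real.exp (δ / 2 * ((D : ℝ) ^ 2 * d)) *
            (2 / (1 - Real.exp (-(δ / (2 * ((k + 1 : ℕ) : ℝ)) / Real.sqrt d))) * Real.exp (δ / (2 * ((k + 1 : ℕ) : ℝ)) / Real.sqrt d)) ^ d *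
            ∑ p ∈ Finset.Icc 1 s, ((admissible p D).card : ℝ) *
              ((2 / (1 - Real.exp (-((κ / 2 - δ / 2 * ((D : ℝ) ^ 2 * Real.sqrt d)) / (p : ℕ) / Real.sqrt d))) *
                Real.exp ((κ / 2 - δ / 2 * ((D : ℝ) ^ 2 * Real.sqrt d)) / (p : ℕ) / Real.sqrt d)) ^ d) ^ (p - 1)) ^ k
          + 2 ^ (k + 1) * (2 ^ ((k + 1) * D) * 2 ^ 2 ^ ((k + 1) * D) * K₀ n ^ ((k + 1) * D)) *
        ((((Js n).image fun x => x + τ n).image (boxIndex L)).card * (Ac * Real.exp (δ / 2 * ((D : ℝ) ^ 2 * d)) * Real.exp (-((κ / 2 - δ / 2 * ((D : ℝ) ^ 2 * Real.sqrt d)) / 2 * v)) *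
          (L : ℝ) ^ d * ∑ p ∈ Finset.Icc 1 s, ((admissible p D).card : ℝ) *
              ((2 / (1 - Real.exp (-((κ / 2 - δ / 2 * ((D : ℝ) ^ 2 * Real.sqrt d)) / 2 / (p : ℕ) / Real.sqrt d))) *
                Real.exp ((κ / 2 - δ / 2 * ((D : ℝ) ^ 2 * Real.sqrt d)) / 2 / (p : ℕ) / Real.sqrt d)) ^ d) ^ (p - 1))) *
        (Ac * Real.exp (δ / 2 * ((D : ℝ) ^ 2 * d)) *
          (2 / (1 - Real.exp (-(δ / (2 * ((k + 1 : ℕ) : ℝ)) / Real.sqrt d))) * Real.exp (δ / (2 * ((k + 1 : ℕ) : ℝ)) / Real.sqrt d)) ^ d *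
          ∑ p ∈ Finset.Icc 1 s, ((admissible p D).card : ℝ) *
              ((2 / (1 - Real.exp (-((κ / 2 - δ / 2 * ((D : ℝ) ^ 2 * Real.sqrt d)) / (p : ℕ) / Real.sqrt d))) *
                Real.exp ((κ / 2 - δ / 2 * ((D : ℝ) ^ 2 * Real.sqrt d)) / (p : ℕ) / Real.sqrt d)) ^ d) ^ (p - 1)) ^ k)
          + 2 ^ ((k + 1) * D) * 2 ^ 2 ^ ((k + 1) * D) * K₀ n ^ ((k + 1) * D) *
        ((((Js n).image fun x => x + τ n).image (boxIndex L)).card * (((k + 1 : ℕ) : ℝ) * (k : ℝ) *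
          ((Ac * Real.exp (δ / 2 * ((D : ℝ) ^ 2 * d)) * ((L : ℝ) ^ d * (2 / (1 - Real.exp (-(δ / (2 * ((k + 1 : ℕ) : ℝ)) / Real.sqrt d))) * Real.exp (δ / (2 * ((k + 1 : ℕ) : ℝ)) / Real.sqrt d)) ^ d) *
              ∑ p ∈ Finset.Icc 1 s, ((admissible p D).card : ℝ) *
              ((2 / (1 - Real.exp (-((κ / 2 - δ / 2 * ((D : ℝ) ^ 2 * Real.sqrt d)) / (p : ℕ) / Real.sqrt d))) *
                Real.exp ((κ / 2 - δ / 2 * ((D : ℝ) ^ 2 * Real.sqrt d)) / (p : ℕ) / Real.sqrt d)) ^ d) ^ (p - 1)) * ((Ac * Real.exp (δ / 2 * ((D : ℝ) ^ 2 * d)) * Real.exp (-(δ / (2 * ((k + 1 : ℕ) : ℝ)) / 2 * ((w : ℝ) + v + 1))) * ((L : ℝ) ^ d * (2 / (1 - Real.exp (-(δ / (2 * ((k + 1 : ℕ) : ℝ)) / 2 / Real.sqrt d))) * Real.exp (δ / (2 * ((k + 1 : ℕ) : ℝ)) / 2 / Real.sqrt d)) ^ d) *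
              ∑ p ∈ Finset.Icc 1 s, ((admissible p D).card : ℝ) *
              ((2 / (1 - Real.exp (-((κ / 2 - δ / 2 * ((D : ℝ) ^ 2 * Real.sqrt d)) / (p : ℕ) / Real.sqrt d))) *
                Real.exp ((κ / 2 - δ / 2 * ((D : ℝ) ^ 2 * Real.sqrt d)) / (p : ℕ) / Real.sqrt d)) ^ d) ^ (p - 1)) *
             (Ac * Real.exp (δ / 2 * ((D : ℝ) ^ 2 * d)) * ((L : ℝ) ^ d * (2 / (1 - Real.exp (-(δ / (2 * ((k + 1 : ℕ) : ℝ)) / Real.sqrt d))) * Real.exp (δ / (2 * ((k + 1 : ℕ) : ℝ)) / Real.sqrt d)) ^ d) *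
              ∑ p ∈ Finset.Icc 1 s, ((admissible p D).card : ℝ) *
              ((2 / (1 - Real.exp (-((κ / 2 - δ / 2 * ((D : ℝ) ^ 2 * Real.sqrt d)) / (p : ℕ) / Real.sqrt d))) *
                Real.exp ((κ / 2 - δ / 2 * ((D : ℝ) ^ 2 * Real.sqrt d)) / (p : ℕ) / Real.sqrt d)) ^ d) ^ (p - 1)) ^ (k - 1)))))
          + (((Js n).image fun x => x + τ n).image (boxIndex L)).card * ((3 : ℝ) ^ (k + 1) *
        (2 ^ ((k + 1) * D) * 2 ^ 2 ^ ((k + 1) * D) * K₀ n ^ ((k + 1) * D) *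
            Real.exp (-(δ / 2 * ((v : ℝ) + 1))) *
          (Ac * Real.exp (δ / 2 * ((D : ℝ) ^ 2 * d)) * (L : ℝ) ^ d * ∑ p ∈ Finset.Icc 1 s, ((admissible p D).card : ℝ) *
              ((2 / (1 - Real.exp (-((κ / 2 - δ / 2 * ((D : ℝ) ^ 2 * Real.sqrt d)) / (p : ℕ) / Real.sqrt d))) *
                Real.exp ((κ / 2 - δ / 2 * ((D : ℝ) ^ 2 * Real.sqrt d)) / (p : ℕ) / Real.sqrt d)) ^ d) ^ (p - 1)) ^ (k + 1)))) / (k + 1)!))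
        + (Is 0).card * (4 * 8 ^ d * Real.exp (-(bs (d + 1) ^ 2 / (2 * (1 / γA))))) ≤ Etot) :
    Real.exp (cumulantSum (gaussianFieldOfKernel K) (hamiltonian s D κ (as 0) (Js 0)) t - Etot) ≤
      ∫ z, cutoffBoltzmann (hamiltonian s D κ (as 0) (Js 0)) (Is 0) (bs 0) z ∂gaussianFieldOfKernel K := by
  classical
  have hL : 0 < L := by omega
  have hA' : A.PosDef := posDef_of_coercive hAs hγA0 hγA
  have hKpsd : IsPosSemidefKernel K := isPosSemidefKernel_kernel hK hA'
  -- invariants along the chain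
  have hinv := chain_invariants (L := L) (w := w) (v := v) (n := d + 1)
    (Bs := fun k => ((Js k).image fun x => x + τ k).image (boxIndex L)) hsupp hA hJI hrecJ hrecI hreca
  -- (2) one class lower step at every frame-`k` datum, from the class rows
  choose! ℓ hP using fun k (hk : k < d + 1) =>
    exists_lower_step_of_classRows_frame hK (s := s) (D := D) (κ := κ) (a := as k) (J := Js k) (I := Is k) (L := L) (w := w) (v := v)
      (γ := γ) (b := bs k) (Ac := Ac) hΛ hAs hγA0 hγA hθ hJc hJcγ hV hM hV₂ hM₂ hV₄ hκ (hinv k hk.le).1 (hinv k hk.le).2.2.1 hAc0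
      (hinv k hk.le).2.1 hL2 hv (hb k hk) hγ0 hγ1 (hsmall k hk) (σ (k + 1)) (τ k) (hΓΛ k hk) (hBΛ k hk) (hKbs k hk)
      (hKuI k hk) (hKuK k hk) (hK₀ k hk) (hK₀1 k hk) (hε₁ k hk) (hε₂ k hk) hhalf hsmallγ hδ hδle hres t
  -- (1) the class lower chain down to the class Appendix A, fed with the chosen exponents
  have hchain := lowerPavementChain_appendixA hK hAs hγA0 hγA hθ hJc hJcγ hV hM hguard hκ hL hw hv hγ0 hγ1 hAc0 hsupp hA hJI hrecJ hrecI hreca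
    hrecb hb hσ0 hrecσ (Bs := fun k => ((Js k).image fun x => x + τ k).image (boxIndex L)) (fun k _ => subset_rfl) hΓΛ hBΛ hKbs ℓ
    (fun k hk => (hP k hk).1) hsep hI0 hbterm (s := s) (D := D)
  -- (3) collecting the errors
  have hJe : Js (d + 1) = ∅ := chain_eq_empty_of_sep hL hrecJ hsep
  refine exp_cumulantSum_sub_le_integral_of_chain hKpsd (as 0) (fun R _ z => rfl) hsupp hrecJ hreca hσ0 hrecσ hJe ℓ _ _ ?_
    (fun k hk => (hP k hk).2) hledger
  -- the chain's exponent `Σ_k(−e₅₁₁ − e₅₃₄ − 2P + Σ_□ℓ) − a_A` is `Σ_k(Σ_□ℓ − c_k) − a_A`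
  refine (congrArg Real.exp ?_).trans_le hchain
  congr 1
  exact Finset.sum_congr rfl fun k _ => by ring

end Assembly

end Literature.MathematicalPhysics.QuantumFieldTheory.Balaban1983to89.B1Eq324BenfattoKernelSect5LowerAssembly

end
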